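import Summits.ValiantsHypothesis.ValiantsHypothesis.Theses.ProjectionRigidity
import Summits.ValiantsHypothesis.ValiantsHypothesis.Theorems.ProjOptimalUnique.Negative.PurifiedTwist
import Summits.ValiantsHypothesis.ValiantsHypothesis.Theorems.ProjectionRigidityProjLaplaceDoublingContent

/-!
# Refutation of `ProjectionRigidity.ProjOptimalUnique` (stmt-ValiantsHypothesis-16001) and of its
# level-3 instance `ProjectionRigidity.ProjOptimalUniqueThree` (stmt-ValiantsHypothesis-16004)

Route `ValiantsHypothesis/ProjectionRigidity` posits (`ProjOptimalUnique`, crux, rank 2) that for every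
`n ≥ 3` any two PURE projections `A, B` of `DET` (every cell a variable `X v` or a constant `C c`) of the
optimal size `m = pdc(per_n)` with `det A = det B = per_n` satisfy `B = P·A(γx)·Q` or `B = P·A(γx)ᵀ·Q`
with constant `P, Q ∈ GL_m(ℂ)` and `γ ∈ permSymmetrySubst ℂ n`; `ProjOptimalUniqueThree` (support) is the
instance `n = 3`, `m = 7`, and with `pdc(per₃) = 7` (tree: `detProjectionComplexity_perPoly_three`) the
level-3 instance of the crux IS the support item (tree: `projOptimalUniqueThree_of_projOptimalUnique`).

Both are FALSE.  Witness (tree, `Theorems/ProjOptimalUnique/Negative/PurifiedTwist.lean`,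
`exists_grenet_purifiedTwist`, found by the disprover seat of the sibling crux stmt-16002): Grenet's
`7 × 7` projection `A = gA` of `per₃` and the PURIFIED single-syzygy Koszul twist
`K = P₀ · gA · (1 + D) · Q₀` (`P₀, Q₀ ∈ SL₇(ℤ)` explicit), a `{0, ±1, X}`-valued `7 × 7` matrix with
`det K = per₃`:
```
K = !![X00, X00, X10, X20, 0,   1,   X22;
       X21, X00, X10, X20, 1,   X01, X12;
       X10, -1,  X21, 0,   X21, X11, X02;
       X11, 0,   X01, -1,  X01, 1,   X22;
       1,   0,   0,   0,   0,   0,   X02;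
       0,   0,   1,   0,   1,   0,   X12;
       0,   0,   0,   0,   0,   1,   X22]
```
Invariant separating the orbits: the coefficient matrix `lin_w A` of each of the SIX variables
`X(r, c)`, `c ≠ 1`, of `A` is supported in a single row (rank `≤ 1`), while FIVE variables of `K`
(`X00, X10, X21, X11, X01`) have a coefficient matrix with an invertible `2 × 2` minor and pairwise
PRIVATE cells (a cell of `K` holding exactly that variable).  Every `γ ∈ permSymmetrySubst ℂ 3` is a
MONOMIAL matrix (row `v` of `γ` is `c_v • e_{f v}`), and `lin_v(P · A(γx) · Q) = c_v • P · lin_{f v} A · Q`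
(resp. with `lin_{f v} A` transposed).  So if `K = P·A(γx)·Q` (or the transposed form), each of the
five big variables `v` of `K` has `f v ∈ {X01, X11, X21}` (else `lin_v K` would have rank `≤ 1`); by
pigeonhole two distinct big variables `v ≠ v'` share `f v = f v'`, so `lin_v K` and `lin_{v'} K` are
both scalar multiples of ONE matrix `N`; reading them at the private cell of `v` gives `c_v · N_cell = 1`
and `c_{v'} · N_cell = 0`, whence `c_{v'} = 0`, `lin_{v'} K = 0` — contradicting its non-zero minor.

Classification (for the planner): `refuted-substantive`.  The witness is an honest optimal pure
projection with integer constants at the only certifiable level `n = 3` (no degenerate case, no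
missing side condition is exploited: purity, optimal size and `n ≥ 3` all hold); the kill criterion
of the route ("a second `GL₇(ℂ)² × G_per × ᵀ`-orbit of `7 × 7` projections of `per₃`") is met
verbatim.  No cheap repair: restricting to `n ≥ 4` makes the statement uncertifiable (`pdc(per₄)` is
open) and the purification mechanism (integer gauge of a single-syzygy twist) is not visibly tied
to `n = 3`; uniqueness modulo POLYNOMIAL gauge `GL_m(ℂ[x])²` is a different statement that does not
feed `ProjLaplaceDoubling` (which becomes vacuously true: tree
`projLaplaceDoubling_of_not_projOptimalUniqueThree`).

Monomiality of `permSymmetrySubst` and the coefficient-matrix calculus are adapted from the tree's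
`Theorems/GrenetRigidityOptimalUniqueRefutation.lean` / `…/Negative/NotToricUnique.lean`.
-/

noncomputable section

-- single-conjunct layout: Sub = Summit, duplicated namespace component intended
set_option linter.dupNamespace false

namespace Summit.ValiantsHypothesis.ValiantsHypothesis.Theorems

open MvPolynomial Matrix
open scoped Kronecker
open Literature.Computability.AlgebraicComplexity
open Summit.ValiantsHypothesis.ValiantsHypothesis.Theses.ProjectionRigidity

/-- Refutes `ProjectionRigidity.ProjOptimalUniqueThree` (stmt-ValiantsHypothesis-16004): Grenet's
`7 × 7` projection of `per₃` and its purified single-syzygy Koszul twist `K` (tree: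
`exists_grenet_purifiedTwist`) are pure `7 × 7` projections of `DET` with determinant `per₃` in
different `GL₇(ℂ) × GL₇(ℂ) × permSymmetrySubst ℂ 3 × ᵀ` classes (five variables of `K` with a rank-two
coefficient matrix and private cells, against three candidates in Grenet's matrix). [folklore] -/
theorem not_ProjOptimalUniqueThree : ¬ ProjOptimalUniqueThree := by
  intro hU3
  obtain ⟨A, K, hA, hK, det_A, det_K, hrow, hminor, hcell⟩ :=
    Summit.ValiantsHypothesis.ValiantsHypothesis.Theorems.ProjOptimalUnique.Negative.exists_grenet_purifiedTwist
  -- ### both matrices are pure projections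
  have pure_A : ∀ i j, (∃ v, A i j = X v) ∨ ∃ c, A i j = C c := fun i j => by
    rcases hA i j with h | h | ⟨w, h⟩
    · exact Or.inr ⟨0, by rw [h, map_zero]⟩
    · exact Or.inr ⟨1, by rw [h, map_one]⟩
    · exact Or.inl ⟨w, h⟩
  have pure_K : ∀ i j, (∃ v, K i j = X v) ∨ ∃ c, K i j = C c := fun i j => by
    rcases hK i j with h | h | h | ⟨w, h⟩
    · exact Or.inr ⟨0, by rw [h, map_zero]⟩
    · exact Or.inr ⟨1, by rw [h, map_one]⟩
    · exact Or.inr ⟨-1, by rw [h, map_neg, map_one]⟩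
    · exact Or.inl ⟨w, h⟩
  have coeff_one_single : ∀ v : Fin 3 × Fin 3,
      (1 : MvPolynomial (Fin 3 × Fin 3) ℂ).coeff (Finsupp.single v 1) = 0 := fun v => by
    rw [MvPolynomial.coeff_one, if_neg]
    exact Ne.symm (Finsupp.single_ne_zero.mpr one_ne_zero)
  -- ### every realised symmetry of `per₃` is a monomial substitution of the variables
  have rm_mul : ∀ {ι : Type} [Fintype ι] [DecidableEq ι] {M N : Matrix ι ι ℂ},
      (∀ i, ∃ (j : ι) (c : ℂ), ∀ j', M i j' = if j' = j then c else 0) →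
      (∀ i, ∃ (j : ι) (c : ℂ), ∀ j', N i j' = if j' = j then c else 0) →
      ∀ i, ∃ (j : ι) (c : ℂ), ∀ j', (M * N) i j' = if j' = j then c else 0 := by
    intro ι _ _ M N hM hN i
    obtain ⟨j, c, hj⟩ := hM i
    obtain ⟨l, d, hl⟩ := hN j
    refine ⟨l, c * d, fun j' => ?_⟩
    simp only [Matrix.mul_apply, hj, ite_mul, zero_mul, Finset.sum_ite_eq', Finset.mem_univ, if_true,
      hl, mul_ite, mul_zero]
  have rm_diag : ∀ {ι : Type} [DecidableEq ι] (d : ι → ℂ),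
      ∀ i, ∃ (j : ι) (c : ℂ), ∀ j', Matrix.diagonal d i j' = if j' = j then c else 0 := by
    intro ι _ d i
    refine ⟨i, d i, fun j' => ?_⟩
    by_cases h : j' = i
    · subst h; simp
    · simp [h, Matrix.diagonal_apply_ne _ (Ne.symm h)]
  have rm_perm : ∀ {ι : Type} [DecidableEq ι] (π : Equiv.Perm ι),
      ∀ i, ∃ (j : ι) (c : ℂ), ∀ j', π.permMatrix ℂ i j' = if j' = j then c else 0 := fun π i =>
    ⟨π i, 1, fun j' => by simp [Equiv.Perm.permMatrix, PEquiv.toMatrix_apply, Equiv.toPEquiv_apply, eq_comm]⟩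
  have inv_perm : ∀ {ι : Type} [Fintype ι] [DecidableEq ι] (π : Equiv.Perm ι),
      (π.permMatrix ℂ)⁻¹ = π⁻¹.permMatrix ℂ := by
    intro ι _ _ π
    apply Matrix.inv_eq_right_inv
    rw [← Matrix.permMatrix_mul, inv_mul_cancel, Matrix.permMatrix_one]
  have rm_kron : ∀ {ι κ : Type} [DecidableEq ι] [DecidableEq κ] {M : Matrix ι ι ℂ},
      (∀ i, ∃ (j : ι) (c : ℂ), ∀ j', M i j' = if j' = j then c else 0) →
      (∀ i, ∃ (j : ι × κ) (c : ℂ), ∀ j', (M ⊗ₖ (1 : Matrix κ κ ℂ)) i j' = if j' = j then c else 0) ∧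
      (∀ i, ∃ (j : κ × ι) (c : ℂ), ∀ j', ((1 : Matrix κ κ ℂ) ⊗ₖ M) i j' = if j' = j then c else 0) := by
    intro ι κ _ _ M hM
    constructor
    · rintro ⟨i, k⟩
      obtain ⟨j, c, hj⟩ := hM i
      refine ⟨(j, k), c, ?_⟩
      rintro ⟨j', k'⟩
      simp only [Matrix.kronecker_apply, hj, Matrix.one_apply, Prod.mk.injEq]
      by_cases h1 : j' = j <;> by_cases h2 : k = k' <;> simp [h1, h2, eq_comm]
    · rintro ⟨k, i⟩
      obtain ⟨j, c, hj⟩ := hM i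
      refine ⟨(k, j), c, ?_⟩
      rintro ⟨k', j'⟩
      simp only [Matrix.kronecker_apply, hj, Matrix.one_apply, Prod.mk.injEq]
      by_cases h1 : j' = j <;> by_cases h2 : k = k' <;> simp [h1, h2, eq_comm]
  have rm_mono : ∀ {m : ℕ} {g : GL (Fin m) ℂ}, g ∈ monomialSubgroup ℂ m →
      ∀ i, ∃ (j : Fin m) (c : ℂ), ∀ j', (g : Matrix (Fin m) (Fin m) ℂ) i j' = if j' = j then c else 0 := by
    intro m g hg
    induction hg using Subgroup.closure_induction'' with
    | mem x hx =>
      rcases hx with ⟨π, hπ⟩ | ⟨d, hd⟩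
      · rw [hπ]; exact rm_perm π
      · rw [hd]; exact rm_diag d
    | inv_mem x hx =>
      rcases hx with ⟨π, hπ⟩ | ⟨d, hd⟩
      · rw [Matrix.coe_units_inv, hπ, inv_perm]; exact rm_perm _
      · rw [Matrix.coe_units_inv, hd, Matrix.inv_diagonal]; exact rm_diag _
    | one => simpa using rm_diag (fun _ : Fin m => (1 : ℂ))
    | mul x y _ _ hx hy => rw [Units.val_mul]; exact rm_mul hx hy
  have hleft : ∀ {γ : GL (Fin 3 × Fin 3) ℂ}, γ ∈ leftMonomialSubst ℂ 3 →
      ∀ i, ∃ (j : Fin 3 × Fin 3) (c : ℂ), ∀ j',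
        (γ : Matrix (Fin 3 × Fin 3) (Fin 3 × Fin 3) ℂ) i j' = if j' = j then c else 0 := by
    intro γ hγ
    induction hγ using Subgroup.closure_induction'' with
    | mem x hx => obtain ⟨g, hg, hx⟩ := hx; rw [hx]; exact (rm_kron (rm_mono hg)).1
    | inv_mem x hx =>
      obtain ⟨g, hg, hx⟩ := hx
      rw [Matrix.coe_units_inv, hx, Matrix.inv_kronecker, inv_one, ← Matrix.coe_units_inv]
      exact (rm_kron (rm_mono (Subgroup.inv_mem _ hg))).1
    | one => simpa using rm_diag (fun _ : Fin 3 × Fin 3 => (1 : ℂ))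
    | mul x y _ _ hx hy => rw [Units.val_mul]; exact rm_mul hx hy
  have hright : ∀ {γ : GL (Fin 3 × Fin 3) ℂ}, γ ∈ rightMonomialSubst ℂ 3 →
      ∀ i, ∃ (j : Fin 3 × Fin 3) (c : ℂ), ∀ j',
        (γ : Matrix (Fin 3 × Fin 3) (Fin 3 × Fin 3) ℂ) i j' = if j' = j then c else 0 := by
    intro γ hγ
    induction hγ using Subgroup.closure_induction'' with
    | mem x hx => obtain ⟨g, hg, hx⟩ := hx; rw [hx]; exact (rm_kron (rm_mono hg)).2
    | inv_mem x hx =>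
      obtain ⟨g, hg, hx⟩ := hx
      rw [Matrix.coe_units_inv, hx, Matrix.inv_kronecker, inv_one, ← Matrix.coe_units_inv]
      exact (rm_kron (rm_mono (Subgroup.inv_mem _ hg))).2
    | one => simpa using rm_diag (fun _ : Fin 3 × Fin 3 => (1 : ℂ))
    | mul x y _ _ hx hy => rw [Units.val_mul]; exact rm_mul hx hy
  have rm_symm : ∀ {γ : GL (Fin 3 × Fin 3) ℂ}, γ ∈ permSymmetrySubst ℂ 3 →
      ∀ i, ∃ (j : Fin 3 × Fin 3) (c : ℂ), ∀ j',
        (γ : Matrix (Fin 3 × Fin 3) (Fin 3 × Fin 3) ℂ) i j' = if j' = j then c else 0 := by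
    intro γ hγ
    induction hγ using Subgroup.closure_induction'' with
    | mem x hx =>
      rcases hx with (hx | hx) | hx
      · exact hleft hx
      · exact hright hx
      · have hx' : (x : Matrix (Fin 3 × Fin 3) (Fin 3 × Fin 3) ℂ) =
            Equiv.Perm.permMatrix ℂ (Equiv.prodComm (Fin 3) (Fin 3)) := hx
        rw [hx']; exact rm_perm _
    | inv_mem x hx =>
      rcases hx with (hx | hx) | hx
      · exact hleft (Subgroup.inv_mem _ hx)
      · exact hright (Subgroup.inv_mem _ hx)
      · have hx' : (x : Matrix (Fin 3 × Fin 3) (Fin 3 × Fin 3) ℂ) =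
            Equiv.Perm.permMatrix ℂ (Equiv.prodComm (Fin 3) (Fin 3)) := hx
        rw [Matrix.coe_units_inv, hx', inv_perm]; exact rm_perm _
    | one => simpa using rm_diag (fun _ : Fin 3 × Fin 3 => (1 : ℂ))
    | mul x y _ _ hx hy => rw [Units.val_mul]; exact rm_mul hx hy
  -- ### linear parts (coefficient matrices of the variables)
  obtain ⟨lin, hlin⟩ : ∃ f : Fin 3 × Fin 3 → Matrix (Fin 7) (Fin 7) (MvPolynomial (Fin 3 × Fin 3) ℂ) →
      Matrix (Fin 7) (Fin 7) ℂ, ∀ v M, f v M = Matrix.of fun i j => (M i j).coeff (Finsupp.single v 1) :=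
    ⟨_, fun _ _ => rfl⟩
  have lin_C_mul : ∀ v (P : Matrix (Fin 7) (Fin 7) ℂ) M, lin v (P.map C * M) = P * lin v M := by
    intro v P M
    apply Matrix.ext; intro i j
    simp [hlin, Matrix.mul_apply, MvPolynomial.coeff_sum, MvPolynomial.coeff_C_mul]
  have lin_mul_C : ∀ v M (Q : Matrix (Fin 7) (Fin 7) ℂ), lin v (M * Q.map C) = lin v M * Q := by
    intro v M Q
    apply Matrix.ext; intro i j
    have hc : ∀ (p : MvPolynomial (Fin 3 × Fin 3) ℂ) (a : ℂ),
        (p * C a).coeff (Finsupp.single v 1) = p.coeff (Finsupp.single v 1) * a := fun p a => by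
      rw [mul_comm, MvPolynomial.coeff_C_mul, mul_comm]
    simp [hlin, Matrix.mul_apply, MvPolynomial.coeff_sum, hc]
  have lin_transpose : ∀ v M, lin v Mᵀ = (lin v M)ᵀ := fun v M => by
    apply Matrix.ext; intro i j; simp [hlin]
  -- a linear substitution `Γ` acts on the linear parts of the pure matrix `A` through the rows of `Γ`
  have lin_subst : ∀ (Γ : Matrix (Fin 3 × Fin 3) (Fin 3 × Fin 3) ℂ) (v : Fin 3 × Fin 3),
      lin v (A.map (linSubst (Fin 3 × Fin 3) ℂ Γ)) = ∑ w, Γ v w • lin w A := by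
    intro Γ v
    apply Matrix.ext; intro i j
    simp only [hlin, Matrix.map_apply, Matrix.of_apply, Matrix.sum_apply, Matrix.smul_apply, smul_eq_mul]
    rcases hA i j with h | h | ⟨w, h⟩ <;> rw [h]
    · simp
    · simp [coeff_one_single]
    · simp [linSubst, MvPolynomial.coeff_sum, MvPolynomial.coeff_X, Finsupp.single_left_inj]
  -- ### rank at most one (a single non-zero row) is preserved by constant gauge and transposition
  have rk_map : ∀ {N : Matrix (Fin 7) (Fin 7) ℂ} (P Q : Matrix (Fin 7) (Fin 7) ℂ),
      (∃ (U : Matrix (Fin 7) (Fin 1) ℂ) (V : Matrix (Fin 1) (Fin 7) ℂ), N = U * V) →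
      (∃ (U : Matrix (Fin 7) (Fin 1) ℂ) (V : Matrix (Fin 1) (Fin 7) ℂ), P * N * Q = U * V) ∧
      (∃ (U : Matrix (Fin 7) (Fin 1) ℂ) (V : Matrix (Fin 1) (Fin 7) ℂ), P * Nᵀ * Q = U * V) := by
    rintro N P Q ⟨U, V, rfl⟩
    refine ⟨⟨P * U, V * Q, ?_⟩, ⟨P * Vᵀ, Uᵀ * Q, ?_⟩⟩
    · simp only [Matrix.mul_assoc]
    · rw [Matrix.transpose_mul]; simp only [Matrix.mul_assoc]
  -- every variable `X(r,c)`, `c ≠ 1`, of Grenet's matrix lives in a single row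
  have rk_A : ∀ w : Fin 3 × Fin 3, w.2 ≠ 1 →
      ∃ (U : Matrix (Fin 7) (Fin 1) ℂ) (V : Matrix (Fin 1) (Fin 7) ℂ), lin w A = U * V := by
    intro w hw
    refine ⟨Matrix.of fun i _ => if i = ![![(0 : Fin 7), 0, 4], ![0, 0, 5], ![0, 0, 6]] w.1 w.2 then 1 else 0,
      Matrix.of fun _ j => lin w A (![![(0 : Fin 7), 0, 4], ![0, 0, 5], ![0, 0, 6]] w.1 w.2) j, ?_⟩
    apply Matrix.ext; intro i j
    simp only [Matrix.mul_apply, Fintype.sum_unique, Matrix.of_apply, ite_mul, one_mul, zero_mul]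
    split_ifs with h
    · rw [h]
    · rw [hlin, Matrix.of_apply]
      by_contra hne
      rcases hrow i j w hne with h2 | h2
      exacts [hw h2, h h2]
  -- any `2 × 2` minor of a scalar multiple of a rank-one product vanishes
  have minor0 : ∀ (a : ℂ) (U : Matrix (Fin 7) (Fin 1) ℂ) (V : Matrix (Fin 1) (Fin 7) ℂ)
      (r c : Fin 2 → Fin 7), ((a • (U * V)).submatrix r c).det = 0 := by
    intro a U V r c
    simp [Matrix.det_fin_two, Matrix.mul_apply]
    ring
  -- ### the five big variables of `K`: non-zero minors and private cells, in terms of `lin`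
  obtain ⟨bigK, hbigK⟩ : ∃ g : Fin 5 → Fin 3 × Fin 3,
      g = ![((0 : Fin 3), (0 : Fin 3)), (1,0), (2,1), (1,1), (0,1)] := ⟨_, rfl⟩
  obtain ⟨cell, hcellDef⟩ : ∃ g : Fin 5 → Fin 7 × Fin 7,
      g = ![((0 : Fin 7), (0 : Fin 7)), (0,2), (1,0), (3,0), (1,5)] := ⟨_, rfl⟩
  have minorK : ∀ k : Fin 5, ∃ r c : Fin 2 → Fin 7, ((lin (bigK k) K).submatrix r c).det ≠ 0 := by
    intro k
    refine ⟨![![(0 : Fin 7), 1], ![0, 2], ![1, 2], ![2, 3], ![1, 3]] k,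
      ![![(0 : Fin 7), 1], ![0, 2], ![0, 2], ![0, 5], ![2, 5]] k, ?_⟩
    rw [hlin, hbigK]
    exact hminor k
  have cellK : ∀ k l : Fin 5, lin (bigK l) K (cell k).1 (cell k).2 = if l = k then 1 else 0 := by
    intro k l
    rw [hlin, hbigK, hcellDef, Matrix.of_apply]
    exact hcell k l
  -- ### the orbit relation and its action on linear parts
  obtain ⟨P, Q, γ, hγ, hPQ⟩ := hU3 A K pure_A pure_K det_A det_K
  choose f cf hf using rm_symm hγ
  obtain ⟨N, hN, rkN⟩ : ∃ N : Fin 3 × Fin 3 → Matrix (Fin 7) (Fin 7) ℂ,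
      (∀ v, lin v K = cf v • N (f v)) ∧
      (∀ w : Fin 3 × Fin 3, w.2 ≠ 1 →
        ∃ (U : Matrix (Fin 7) (Fin 1) ℂ) (V : Matrix (Fin 1) (Fin 7) ℂ), N w = U * V) := by
    have hsub : ∀ v, lin v (Matrix.linSubstEntries γ A) = cf v • lin (f v) A := fun v => by
      rw [Matrix.linSubstEntries, lin_subst]
      simp only [hf v, ite_smul, zero_smul, Finset.sum_ite_eq', Finset.mem_univ, if_true]
    rcases hPQ with hB | hB
    · refine ⟨fun w => (P : Matrix (Fin 7) (Fin 7) ℂ) * lin w A * (Q : Matrix (Fin 7) (Fin 7) ℂ),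
        fun v => ?_, fun w hw => (rk_map _ _ (rk_A w hw)).1⟩
      show lin v K = cf v • ((P : Matrix (Fin 7) (Fin 7) ℂ) * lin (f v) A * (Q : Matrix (Fin 7) (Fin 7) ℂ))
      rw [hB, lin_mul_C, lin_C_mul, hsub, Matrix.mul_smul, Matrix.smul_mul]
    · refine ⟨fun w => (P : Matrix (Fin 7) (Fin 7) ℂ) * (lin w A)ᵀ * (Q : Matrix (Fin 7) (Fin 7) ℂ),
        fun v => ?_, fun w hw => (rk_map _ _ (rk_A w hw)).2⟩
      show lin v K = cf v • ((P : Matrix (Fin 7) (Fin 7) ℂ) * (lin (f v) A)ᵀ * (Q : Matrix (Fin 7) (Fin 7) ℂ))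
      rw [hB, lin_mul_C, lin_C_mul, lin_transpose, hsub, Matrix.transpose_smul, Matrix.mul_smul,
        Matrix.smul_mul]
  -- ### each big variable of `K` is sent to a column-1 variable of `A`
  have col_one : ∀ k : Fin 5, (f (bigK k)).2 = 1 := by
    intro k
    by_contra hne
    obtain ⟨U, V, hUV⟩ := rkN (f (bigK k)) hne
    obtain ⟨r, c, hmin⟩ := minorK k
    apply hmin
    rw [hN, hUV]
    exact minor0 _ _ _ r c
  -- ### pigeonhole: two distinct big variables share their image
  obtain ⟨k, l, hkl, hEq⟩ :=
    Fintype.exists_ne_map_eq_of_card_lt (fun k : Fin 5 => (f (bigK k)).1) (by simp)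
  have hw : f (bigK l) = f (bigK k) := Prod.ext hEq.symm (by rw [col_one, col_one])
  -- ### private cells: the second multiplier vanishes, so its linear part is zero
  have h1 := cellK k k
  have h2 := cellK k l
  rw [if_pos rfl] at h1
  rw [if_neg (Ne.symm hkl)] at h2
  rw [hN, Matrix.smul_apply, smul_eq_mul] at h1 h2
  rw [hw] at h2
  have hNz : N (f (bigK k)) (cell k).1 (cell k).2 ≠ 0 := by
    intro h0
    rw [h0, mul_zero] at h1
    exact zero_ne_one h1
  have hcl : cf (bigK l) = 0 := by
    rcases mul_eq_zero.mp h2 with h | h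
    · exact h
    · exact absurd h hNz
  obtain ⟨r, c, hmin⟩ := minorK l
  apply hmin
  rw [hN, hcl, zero_smul]
  simp

/-- Refutes `ProjectionRigidity.ProjOptimalUnique` (stmt-ValiantsHypothesis-16001): with
`pdc(per₃) = 7` (Alper–Bogart–Velasco 2017 Cor. 1.4 + Grenet, tree `detProjectionComplexity_perPoly_three`)
its level-3 instance is `ProjOptimalUniqueThree` (tree `projOptimalUniqueThree_of_projOptimalUnique`),
refuted above by Grenet's matrix and its purified Koszul twist.  `refuted-substantive`: a genuine
second orbit of optimal pure projections of `per₃` with constants `0, ±1`. [folklore] -/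
theorem not_ProjOptimalUnique : ¬ ProjOptimalUnique := fun h =>
  not_ProjOptimalUniqueThree (projOptimalUniqueThree_of_projOptimalUnique h)

end Summit.ValiantsHypothesis.ValiantsHypothesis.Theorems

end
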